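import Mathlib
import Literature.Geometry.Riemannian.GurskyViaclovskyPath
import HarnessLib

/-!
# GurskyViaclovskyC2Estimate

Topic `Literature/Geometry/Riemannian`. Named literature fact(s) relocated by the gate from `Summits/SmoothPoincare4/SmoothPoincare4/Theorems/EntropyRungChangGurskyYangStubPathHessian.lean`
(accept-time relocation of `[cite]`d propositions written inline in a Summits proposal; human ruling 2026-08-15).
Sources: ChangGurskyYang2003, Chen2005, GuanWang2003, GurskyViaclovsky2003, LiLi2003.

* `Literature.Geometry.Riemannian.gurskyViaclovsky_hessianEstimate_weighted_four`
-/

namespace Literature.Geometry.Riemannian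

open scoped Manifold ContDiff Topology
open Set Filter
open Literature.Geometry.Lorentzian (PseudoRiemannianMetric)
open Literature.Geometry.Lorentzian.PseudoRiemannianMetric
open Literature.Geometry.Riemannian
open Literature.Geometry.Riemannian.GurskyViaclovskyPath

/-- NAMED FACT (**Gursky–Viaclovsky 2003, Prop. 6, the `C²` part, along the Weyl-weighted path;
for the `x`-dependent weight, Chen 2005, Thm. 1(a)**). The source (J. Differential Geom. 63 (2003),
§5, Prop. 6): "Let `u_t` be a `C⁴` solution of (path) for some `δ ≤ t ≤ 1` satisfying
`δ̲ < u_t < δ̄`, and `‖∇u_t‖_{L^∞} < C₁`. Then for `0 < α < 1`, `‖u_t‖_{C^{2,α}} ≤ C₂`, where `C₂`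
depends only upon `δ̲, δ̄, C₁`, and `g`", with the printed proof "The `C²` estimate follows from
the global estimates in [GVNegative], or the local estimates [GuanWang1] and [LiLi2] … the main
fact used in deriving these estimates is that `σ₂^{1/2}(A^t)` is a concave function of the second
derivative variables"; here (path) is `σ₂^{1/2}(g⁻¹A^t_{u_t}) = f(x) e^{2u_t}`,
`A^t_u = A^t_g + ∇²u + ((1−t)/2)(Δu)g + du⊗du − ((2−t)/2)|∇u|²g` (§1). For a right-hand side
`f(x, u)` depending on the point and on the solution, the local Hessian estimate is S. Chen,
IMRN 2005:63, Thm. 1(a): for `F(g⁻¹W) = f(x,u)·h₀`, `W = ∇²u + a(x)du⊗du + b(x)|∇u|²g + B(x)`,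
`b < −δ₁`, `a + n b < −δ₂`, `F` positive, concave, monotone and homogeneous of degree one on its
cone, and a `C⁴` solution on a geodesic ball `B_r`,
"`sup_{B_{r/2}} (|∇²u| + |∇u|²) ≤ C₁(n, r, ‖a‖_{C²}, ‖b‖_{C²}, ‖B‖_{C²}, ‖g‖_{C³}, h₀, δ₁, δ₂, c_sup(r))`"
(`c_sup(r)` = the supremum over the ball of `f + |∇_x f| + |f_z| + |∇²_x f| + |∇_x f_z| + |f_zz|`
along `(x, u(x))`), and ibid. Cor. 2, which is literally Gursky–Viaclovsky's (path):
"`σ_k^{1/k}(t λ(A_{g_u}) + s σ₁(λ(A_{g_u})) g) = f₀(x)e^{2u}` … `C = C(n, k, r, ‖g‖_{C⁴}, ‖f₀‖_{C²})`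
but is independent of `t, s` and `inf f₀`".
**Vended form** — the special case the line `gv-continuity-path` consumes: dimension `n = 4`,
`C^∞` data on `ℝ⁴`-charts, the WEYL-WEIGHTED path of Chang–Gursky–Yang 2003, (1.10) (`α = 1`)
read on the conformal metric (`Literature.Geometry.Riemannian.GurskyViaclovskyPath.IsPathSolution`:
`h = e^{−2u} g` Riemannian, `u ∈ C^∞`, `R_h > 0`, and
`P_t(h) = σ₂(A_h) − ¼|W_h|² + (1−t)(2−t)R_h²/6 = q·e^{8u}`, which on the background `g` is
`σ₂^{1/2}(g⁻¹A^t_u) = f(x,u) := ((1/16)|W_g|²_g + (q/4)e^{4u})^{1/2}` with `A^t_u ∈ Γ₂⁺`, module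
docstring "Dictionary" of `GurskyViaclovskyPath.lean`; Gursky–Viaclovsky, §1: "The choice of the
right hand side in (PDE) is quite flexible; the key requirement is simply that the exponent is a
positive multiple of `u`"), and as OUTPUT only the sup bound on `|∇²u|²_g`
(`g.normSq x (g.hessian u x)`, the `(0,2)`-norm of the covariant Hessian of `u` for `g`): on a
compact `M⁴` with a `C^∞` Riemannian `g`, for a `C^∞` right side `q > 0`, `δ ≤ 1` and levels
`C₀, C₁` there is `C₂ = C₂(M, g, q, δ, C₀, C₁)` with `|∇²u|²_g ≤ C₂` pointwise for EVERY smooth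
admissible solution `(h = e^{−2u}g, u)` at any `t ∈ [δ, 1]` with `|u| ≤ C₀` and `|∇u|²_g ≤ C₁`.
In Chen's bookkeeping (proof of his Cor. 1–2): `W = A¹_u = ∇²u + du⊗du − ½|∇u|²g + A¹_g`
(`a = 1`, `b = −½`, `B = A¹_g`, so `δ₁ = ½`, `δ₂ = 1`), `F ∝ σ₂^{1/2}(λ + ((1−t)/2)σ₁(λ)e)`
(`A^t = A¹ + ((1−t)/2)tr(A¹)g`, Gursky–Viaclovsky §1; concave by Li–Li 2003, Chen §1; the
normalising factor `1 + 2(1−t) ∈ [1, 3−2δ]`), `h₀ = 1`, and `c_sup` is controlled by `C₀`,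
`‖q‖_{C²}`, `‖|W_g|²_g‖_{C²}` and `(min q)e^{−4C₀}` on the compact `M`, covered by finitely many
geodesic half-balls; the `C^{2,α}` half of Prop. 6 (Evans 1982, Krylov) is NOT stated here.
A deep estimate (maximum-principle computations for concave fully nonlinear equations in normal
coordinates); nothing of it is in Mathlib or the tree: no `_holds`. (The body is written without
scoped notation — `modelWithCornersSelf ℝ (EuclideanSpace ℝ (Fin 4))` for `𝓡 4`,
`modelWithCornersSelf ℝ ℝ` for `𝓘(ℝ)`, `((⊤ : ℕ∞) : WithTop ℕ∞)` for the smoothness exponent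
`∞` — and with fully qualified tree names, so that it elaborates under any `open` preamble; it
is syntactically the registered stub `stub_pathHessian` of the line.) Users take
`(hH : gurskyViaclovsky_hessianEstimate_weighted_four)`.
-- TODO(general form): Gursky–Viaclovsky 2003, Prop. 6 gives the full `C^{2,α}` bound
-- `‖u_t‖_{C^{2,α}} ≤ C₂(δ̲, δ̄, C₁, g)` (the Hölder half via Evans–Krylov); Chen 2005, Thm. 1
-- gives LOCAL estimates `sup_{B_{r/2}}(|∇²u| + |∇u|²) ≤ C` on geodesic balls, in every dimension
-- `n`, for general structure functions `F` (conditions (S0)–(S2)), general `a(x), b(x), B(x)` and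
-- general positive `f(x,u) h(x,∇u)` (cases (a)–(c)), directly from `C⁰` bounds (no gradient bound
-- needed in case (a)); only the global `n = 4`, `σ₂`, Weyl-weighted consequence is stated.
[cite: GurskyViaclovsky2003, Prop. 6 (§5) and §1 (PDE)] [cite: Chen2005, Thm. 1(a) and Cor. 2]
[cite: GuanWang2003] [cite: LiLi2003] [cite: ChangGurskyYang2003, (1.10)]
[file Geometry/Riemannian/GurskyViaclovskyC2Estimate] -/
def gurskyViaclovsky_hessianEstimate_weighted_four : Prop :=
  ∀ (M : Type) [TopologicalSpace M] [T2Space M] [SecondCountableTopology M]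
    [ChartedSpace (EuclideanSpace ℝ (Fin 4)) M]
    [IsManifold (modelWithCornersSelf ℝ (EuclideanSpace ℝ (Fin 4))) ((⊤ : ℕ∞) : WithTop ℕ∞) M]
    [CompactSpace M]
    (g : Literature.Geometry.Lorentzian.PseudoRiemannianMetric
      (modelWithCornersSelf ℝ (EuclideanSpace ℝ (Fin 4))) ((⊤ : ℕ∞) : WithTop ℕ∞)
      (EuclideanSpace ℝ (Fin 4))
      (TangentSpace (modelWithCornersSelf ℝ (EuclideanSpace ℝ (Fin 4))) : M → Type _))
    [g.HasLeviCivita], g.IsRiemannian →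
    ∀ (q : M → ℝ) (δ C₀ C₁ : ℝ),
      ContMDiff (modelWithCornersSelf ℝ (EuclideanSpace ℝ (Fin 4))) (modelWithCornersSelf ℝ ℝ)
        ((⊤ : ℕ∞) : WithTop ℕ∞) q →
      (∀ x, 0 < q x) → δ ≤ 1 →
      ∃ C₂ : ℝ, ∀ t : ℝ, δ ≤ t → t ≤ 1 →
        ∀ (h : Literature.Geometry.Lorentzian.PseudoRiemannianMetric
            (modelWithCornersSelf ℝ (EuclideanSpace ℝ (Fin 4))) ((⊤ : ℕ∞) : WithTop ℕ∞)
            (EuclideanSpace ℝ (Fin 4))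
            (TangentSpace (modelWithCornersSelf ℝ (EuclideanSpace ℝ (Fin 4))) : M → Type _))
          [h.HasLeviCivita] (u : M → ℝ),
          Literature.Geometry.Riemannian.GurskyViaclovskyPath.IsPathSolution g h u t q →
          (∀ x, |u x| ≤ C₀) → (∀ x, g.gradSq u x ≤ C₁) →
          ∀ x, g.normSq x (g.hessian u x) ≤ C₂

end Literature.Geometry.Riemannian
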